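import Summits.PneNP.PneNP.Theorems.CliqueExtLowerBound.Negative.AnchoredThetaAnchor

/-!
# Span lemma, incidences, the sum over class assignments (anchored-theta refutation, part D)

Part of the refutation of `stub_convReplaceable` (line `width-threshold-certificate-sparsity` of
crux stmt-PneNP-10682, `ConvexRankGates.CliqueExtLowerBound`) by the ANCHORED THETA GATE; the final
theorem is `stub_convReplaceable_false` in `ConvReplaceableFalse.lean`, whose module docstring has the
overview. Witness: at `c = 3`, for every `a`, localities `r = 3, s = 4`, at every large `m = n + 2`, the
theta programme on the `n+1` non-anchor vertices with clique parameter `k-1` (`k = ⌈m^{1/4}⌉₊`), fed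
with children `d_j = {{e₀, p_j}}`, `c_j = {{e₀, f(α,γ), f(β,γ)} : γ < h}`, is not replaceable by any
monotone circuit of size `m^a`: Jukna's criterion on the derived coordinates kills both exits.
-/

set_option linter.dupNamespace false

namespace Summit.PneNP.PneNP.Theorems.CliqueExtLowerBound.Negative

open Literature.Computability.Complexity Literature.Combinatorics.SimpleGraph Matrix Finset Filter

noncomputable section

/-! ## D. Helper facts for the finite lower bound -/

section Helpers

variable (n : ℕ)

/-- The localities at which Jukna's criterion is run against a circuit of size `≤ m^a`:
any `rr a` distinct pairs span `≥ w0 a = 4a + 5` vertices, any `ss a` distinct pairs span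
`≥ v0 a = 32 (a + 1)` vertices. -/
def w0 (a : ℕ) : ℕ := 4 * a + 5

/-- See `w0`. -/
def rr (a : ℕ) : ℕ := (w0 a - 1).choose 2 + 1

/-- See `w0`. -/
def v0 (a : ℕ) : ℕ := 32 * (a + 1)

/-- See `w0`. -/
def ss (a : ℕ) : ℕ := (v0 a - 1).choose 2 + 1

/-- Unfolding lemma for `w0`. -/
theorem w0_eq (a : ℕ) : w0 a = 4 * a + 5 := rfl

/-- Unfolding lemma for `rr`. -/
theorem rr_eq (a : ℕ) : rr a = (w0 a - 1).choose 2 + 1 := rfl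

/-- Unfolding lemma for `v0`. -/
theorem v0_eq (a : ℕ) : v0 a = 32 * (a + 1) := rfl

/-- Unfolding lemma for `ss`. -/
theorem ss_eq (a : ℕ) : ss a = (v0 a - 1).choose 2 + 1 := rfl

/-- `rr a ≥ 2` (a legal locality for Jukna's criterion). -/
theorem two_le_rr (a : ℕ) : 2 ≤ rr a := by
  have : 1 ≤ (w0 a - 1).choose 2 := Nat.choose_pos (by rw [w0_eq]; omega)
  rw [rr_eq]; omega

/-- `ss a ≥ 2` (a legal locality for Jukna's criterion). -/
theorem two_le_ss (a : ℕ) : 2 ≤ ss a := by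
  have : 1 ≤ (v0 a - 1).choose 2 := Nat.choose_pos (by rw [v0_eq]; omega)
  rw [ss_eq]; omega

-- the locality constants are never to be unfolded by automation (`(32(a+1)-1).choose 2` blows up `whnf`)
attribute [irreducible] w0 rr v0 ss

/-- `verts` determines the pair. -/
theorem verts_injective : Function.Injective (verts n) := by
  intro p p' hpp
  obtain ⟨α, β, hne, hp⟩ := exists_eq_pair n p
  obtain ⟨α', β', -, hp'⟩ := exists_eq_pair n p'
  rw [verts_pair n hp, verts_pair n hp'] at hpp
  apply Subtype.ext
  rw [hp, hp', Sym2.eq_iff]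
  have hα : α ∈ ({α', β'} : Finset (Fin (n + 1))) := hpp ▸ mem_insert_self α {β}
  have hβ : β ∈ ({α', β'} : Finset (Fin (n + 1))) := hpp ▸ mem_insert_of_mem (mem_singleton_self β)
  rw [mem_insert, mem_singleton] at hα hβ
  rcases hα with rfl | rfl <;> rcases hβ with rfl | rfl
  · exact absurd rfl hne
  · exact Or.inl ⟨rfl, rfl⟩
  · exact Or.inr ⟨rfl, rfl⟩
  · exact absurd rfl hne

/-- The vertex set spanned by a set of coordinates (derived pairs). -/
def spanV (n : ℕ) (P : Finset (Fin (nP (n + 1)))) : Finset (Fin (n + 1)) :=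
  P.biUnion fun j => verts n (pr n j)

/-- Each pair of `P` lies inside the span of `P`. -/
theorem verts_subset_spanV {P : Finset (Fin (nP (n + 1)))} {j : Fin (nP (n + 1))} (hj : j ∈ P) :
    verts n (pr n j) ⊆ spanV n P :=
  subset_biUnion_of_mem (fun j => verts n (pr n j)) hj

/-- **Span lemma**: more than `C(w-1, 2)` distinct pairs span at least `w` vertices. -/
theorem le_card_spanV (P : Finset (Fin (nP (n + 1)))) (w : ℕ) (hP : (w - 1).choose 2 < #P) :
    w ≤ #(spanV n P) := by
  have hinj : Set.InjOn (fun j => verts n (pr n j)) (P : Set (Fin (nP (n + 1)))) := by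
    intro j _ j' _ hjj
    exact (eqv (n + 1)).symm.injective (verts_injective n hjj)
  have hsub : P.image (fun j => verts n (pr n j)) ⊆ (spanV n P).powersetCard 2 := by
    intro V hV
    obtain ⟨j, hj, rfl⟩ := mem_image.1 hV
    rw [mem_powersetCard]
    exact ⟨verts_subset_spanV n hj, card_verts n _⟩
  have h1 : #P ≤ (#(spanV n P)).choose 2 := by
    calc #P = #(P.image fun j => verts n (pr n j)) := (card_image_of_injOn hinj).symm
      _ ≤ #((spanV n P).powersetCard 2) := card_le_card hsub
      _ = (#(spanV n P)).choose 2 := card_powersetCard _ _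
  by_contra hlt
  have h2 : (#(spanV n P)).choose 2 ≤ (w - 1).choose 2 := Nat.choose_le_choose 2 (by omega)
  omega

/-- Anchored clique vectors determine their vertex set. -/
theorem cliqueVec_inj_of_mem {K K' : Finset (Fin (n + 2))} (hK : aA n ∈ K) (hK' : aA n ∈ K')
    (h : cliqueVec K = cliqueVec K') : K = K' := by
  ext v
  by_cases hv : v = aA n
  · subst hv; exact ⟨fun _ => hK', fun _ => hK⟩
  · have key := congrFun h ⟨s(v, aA n), mem_edgeSet_top_iff.2 hv⟩
    simp only [cliqueVec, Sym2.mem_iff, forall_eq_or_imp, forall_eq, hK, hK', and_true] at key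
    simpa using key

/-- Complement indicators determine the set. -/
theorem negVec_injective : Function.Injective fun (M : Finset (EV n)) => fun e => decide (e ∉ M) := by
  intro M M' h
  ext e
  have key := congrFun h e
  simp only [decide_eq_decide] at key
  tauto

/-! ### Incidences of a class assignment -/

variable {n}

/-- The incidences `(α, g j)` for `α ∈ p_j`, `j ∈ Q`. -/
def Inc {Q : Finset (Fin (nP (n + 1)))} {h : ℕ} (g : Q → Fin h) : Finset (Fin (n + 1) × Fin h) :=
  (univ : Finset Q).biUnion fun j => (verts n (pr n j.1)).image fun α => (α, g j)

/-- The edge set an anchored negative must contain when `g` witnesses that all pairs of `Q` are off: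
`e₀` and the class edges of the incidences. -/
def Gset (n : ℕ) {Q : Finset (Fin (nP (n + 1)))} {h : ℕ} (g : Q → Fin h) : Finset (EV n) :=
  insert (e0 n) ((Inc g).image fun x => fE n x.1 x.2.1)

/-- Membership in the incidence set of a class assignment. -/
theorem mem_Inc_iff {Q : Finset (Fin (nP (n + 1)))} {h : ℕ} (g : Q → Fin h) (x : Fin (n + 1) × Fin h) :
    x ∈ Inc g ↔ ∃ j : Q, x.1 ∈ verts n (pr n j.1) ∧ g j = x.2 := by
  constructor
  · intro hx
    obtain ⟨j, -, hj⟩ := mem_biUnion.1 hx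
    obtain ⟨α, hα, rfl⟩ := mem_image.1 hj
    exact ⟨j, hα, rfl⟩
  · rintro ⟨j, hj, hg⟩
    refine mem_biUnion.2 ⟨j, mem_univ _, mem_image.2 ⟨x.1, hj, ?_⟩⟩
    rw [hg]

/-- The forced edge set of a class assignment has `#Inc + 1` edges (class edges are distinct and avoid `e₀`). -/
theorem card_Gset {Q : Finset (Fin (nP (n + 1)))} {h : ℕ} (hh : 2 * h ≤ n) (g : Q → Fin h) :
    #(Gset n g) = #(Inc g) + 1 := by
  have hinj : Set.InjOn (fun x : Fin (n + 1) × Fin h => fE n x.1 x.2.1) (Inc g : Set _) := by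
    intro x _ y _ hxy
    obtain ⟨h1, h2⟩ := fE_inj n hh x.2.2 y.2.2 hxy
    exact Prod.ext h1 (Fin.ext h2)
  rw [Gset, card_insert_of_notMem, card_image_of_injOn hinj]
  intro he
  obtain ⟨x, -, hx⟩ := mem_image.1 he
  exact fE_ne_e0 n x.1 (show x.2.1 + 1 ≤ n by have := x.2.2; omega) hx

/-- At most two incidences per pair. -/
theorem card_Inc_le {Q : Finset (Fin (nP (n + 1)))} {h : ℕ} (g : Q → Fin h) : #(Inc g) ≤ 2 * #Q := by
  calc #(Inc g) ≤ ∑ j : Q, #((verts n (pr n j.1)).image fun α => (α, g j)) := card_biUnion_le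
    _ ≤ ∑ _j : Q, 2 := sum_le_sum fun j _ => card_image_le.trans (card_verts n _).le
    _ = 2 * #Q := by simp [mul_comm]

/-- Every spanned vertex carries an incidence. -/
theorem card_spanV_le_card_Inc {Q : Finset (Fin (nP (n + 1)))} {h : ℕ} (g : Q → Fin h) :
    #(spanV n Q) ≤ #(Inc g) := by
  have : spanV n Q ⊆ (Inc g).image Prod.fst := by
    intro α hα
    obtain ⟨j, hj, hα'⟩ := mem_biUnion.1 hα
    exact mem_image.2 ⟨(α, g ⟨j, hj⟩), (mem_Inc_iff g _).2 ⟨⟨j, hj⟩, hα', rfl⟩, rfl⟩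
  exact (card_le_card this).trans card_image_le

/-- Every used class carries two incidences. -/
theorem two_mul_card_image_le_card_Inc {Q : Finset (Fin (nP (n + 1)))} {h : ℕ} (g : Q → Fin h) :
    2 * #((univ : Finset Q).image g) ≤ #(Inc g) := by
  rw [card_eq_sum_card_image Prod.snd (Inc g)]
  have hR : (univ : Finset Q).image g ⊆ (Inc g).image Prod.snd := by
    intro γ hγ
    obtain ⟨j, -, rfl⟩ := mem_image.1 hγ
    obtain ⟨α, β, -, hp⟩ := exists_eq_pair n (pr n j.1)
    refine mem_image.2 ⟨(α, g j), (mem_Inc_iff g _).2 ⟨j, ?_, rfl⟩, rfl⟩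
    rw [verts_pair n hp]; exact mem_insert_self _ _
  calc 2 * #((univ : Finset Q).image g) = ∑ _γ ∈ (univ : Finset Q).image g, 2 := by simp [mul_comm]
    _ ≤ ∑ γ ∈ (univ : Finset Q).image g, #((Inc g).filter fun x => x.2 = γ) := by
        refine sum_le_sum fun γ hγ => ?_
        obtain ⟨j, -, rfl⟩ := mem_image.1 hγ
        obtain ⟨α, β, hne, hp⟩ := exists_eq_pair n (pr n j.1)
        have hα : (α, g j) ∈ (Inc g).filter fun x => x.2 = g j :=
          mem_filter.2 ⟨(mem_Inc_iff g _).2 ⟨j, by rw [verts_pair n hp]; simp, rfl⟩, rfl⟩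
        have hβ : (β, g j) ∈ (Inc g).filter fun x => x.2 = g j :=
          mem_filter.2 ⟨(mem_Inc_iff g _).2 ⟨j, by rw [verts_pair n hp]; simp, rfl⟩, rfl⟩
        have hne' : (α, g j) ≠ (β, g j) := fun h => hne (Prod.ext_iff.1 h).1
        calc 2 = #({(α, g j), (β, g j)} : Finset _) := (card_pair hne').symm
          _ ≤ _ := card_le_card (by
              intro x hx
              rw [mem_insert, mem_singleton] at hx
              rcases hx with rfl | rfl
              · exact hα
              · exact hβ)
    _ ≤ ∑ γ ∈ (Inc g).image Prod.snd, #((Inc g).filter fun x => x.2 = γ) :=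
        sum_le_sum_of_subset_of_nonneg hR fun _ _ _ => Nat.zero_le _

/-! ### The combinatorial sum over class assignments -/

/-- `h^c · D^{v'} ≤ D^{max (4 v') (2 c)}` when `h² ≤ D³`. -/
theorem pow_mul_pow_le_pow_max {h D : ℕ} (hhD : h ^ 2 ≤ D ^ 3) (hD : 1 ≤ D) (c v' : ℕ) :
    h ^ c * D ^ v' ≤ D ^ max (4 * v') (2 * c) := by
  have hsq : (h ^ c * D ^ v') ^ 2 ≤ (D ^ max (4 * v') (2 * c)) ^ 2 := by
    have e1 : (h ^ c * D ^ v') ^ 2 = (h ^ 2) ^ c * D ^ (2 * v') := by ring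
    rw [e1]
    have h3 : (h ^ 2) ^ c ≤ D ^ (3 * c) := by
      calc (h ^ 2) ^ c ≤ (D ^ 3) ^ c := Nat.pow_le_pow_left hhD c
        _ = D ^ (3 * c) := by ring
    rcases le_or_gt (2 * c) (4 * v') with hle | hlt
    · rw [max_eq_left hle]
      calc (h ^ 2) ^ c * D ^ (2 * v') ≤ D ^ (3 * c) * D ^ (2 * v') := Nat.mul_le_mul_right _ h3
        _ = D ^ (3 * c + 2 * v') := by rw [← pow_add]
        _ ≤ D ^ (4 * v' * 2) := Nat.pow_le_pow_right hD (by omega)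
        _ = (D ^ (4 * v')) ^ 2 := by ring
    · rw [max_eq_right hlt.le]
      calc (h ^ 2) ^ c * D ^ (2 * v') ≤ D ^ (3 * c) * D ^ (2 * v') := Nat.mul_le_mul_right _ h3
        _ = D ^ (3 * c + 2 * v') := by rw [← pow_add]
        _ ≤ D ^ (2 * c * 2) := Nat.pow_le_pow_right hD (by omega)
        _ = (D ^ (2 * c)) ^ 2 := by ring
  exact (Nat.pow_le_pow_iff_left (by norm_num : (2 : ℕ) ≠ 0)).1 hsq

/-- Functions with image inside `R` number at most `#R ^ #Q`. -/
theorem card_filter_image_subset_le {ι κ : Type*} [Fintype ι] [DecidableEq ι] [Fintype κ] [DecidableEq κ]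
    (R : Finset κ) :
    #((univ : Finset (ι → κ)).filter fun g => univ.image g ⊆ R) ≤ #R ^ Fintype.card ι := by
  classical
  have hsub : ((univ : Finset (ι → κ)).filter fun g => univ.image g ⊆ R) ⊆
      (univ : Finset (ι → R)).image fun g' => Subtype.val ∘ g' := by
    intro g hg
    rw [mem_filter] at hg
    have hgR : ∀ i, g i ∈ R := fun i => hg.2 (mem_image_of_mem g (mem_univ i))
    exact mem_image.2 ⟨fun i => ⟨g i, hgR i⟩, mem_univ _, rfl⟩
  calc _ ≤ #((univ : Finset (ι → R)).image fun g' => Subtype.val ∘ g') := card_le_card hsub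
    _ ≤ #(univ : Finset (ι → R)) := card_image_le
    _ = #R ^ Fintype.card ι := by simp

/-- **The sum over class assignments**: `Σ_g h^{-#range g} ≤ (q₀ + 1) q₀^{q₀}` for functions on a
`q₀`-element type. -/
theorem sum_inv_pow_card_image_le {ι : Type*} [Fintype ι] [DecidableEq ι] (h : ℕ) (hh : 1 ≤ h) :
    ∑ g : ι → Fin h, ((h : ℝ) ^ #((univ : Finset ι).image g))⁻¹ ≤
      (Fintype.card ι + 1) * (Fintype.card ι) ^ (Fintype.card ι) := by
  classical
  set q₀ := Fintype.card ι with hq₀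
  have hhpos : (0 : ℝ) < h := by exact_mod_cast hh
  -- the admissible ranges
  let 𝓡 : Finset (Finset (Fin h)) := (univ : Finset (Fin h)).powerset.filter fun R => #R ≤ q₀
  have step1 : ∀ g : ι → Fin h, ((h : ℝ) ^ #((univ : Finset ι).image g))⁻¹ ≤
      ∑ R ∈ 𝓡.filter (fun R => univ.image g ⊆ R), ((h : ℝ) ^ #R)⁻¹ := by
    intro g
    have hmem : univ.image g ∈ 𝓡.filter (fun R => univ.image g ⊆ R) := by
      rw [mem_filter, mem_filter, mem_powerset]
      exact ⟨⟨subset_univ _, card_image_le.trans (by simp [hq₀])⟩, subset_rfl⟩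
    exact single_le_sum (f := fun R => ((h : ℝ) ^ #R)⁻¹) (fun R _ => by positivity) hmem
  calc ∑ g : ι → Fin h, ((h : ℝ) ^ #((univ : Finset ι).image g))⁻¹
      ≤ ∑ g : ι → Fin h, ∑ R ∈ 𝓡.filter (fun R => univ.image g ⊆ R), ((h : ℝ) ^ #R)⁻¹ :=
        sum_le_sum fun g _ => step1 g
    _ = ∑ g : ι → Fin h, ∑ R ∈ 𝓡, if univ.image g ⊆ R then ((h : ℝ) ^ #R)⁻¹ else 0 := by
        refine sum_congr rfl fun g _ => ?_
        rw [sum_filter]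
    _ = ∑ R ∈ 𝓡, ∑ g : ι → Fin h, if univ.image g ⊆ R then ((h : ℝ) ^ #R)⁻¹ else 0 := sum_comm
    _ = ∑ R ∈ 𝓡, (#((univ : Finset (ι → Fin h)).filter fun g => univ.image g ⊆ R) : ℝ) * ((h : ℝ) ^ #R)⁻¹ := by
        refine sum_congr rfl fun R _ => ?_
        rw [← sum_filter, sum_const, nsmul_eq_mul]
    _ ≤ ∑ R ∈ 𝓡, ((#R : ℝ) ^ q₀) * ((h : ℝ) ^ #R)⁻¹ := by
        refine sum_le_sum fun R _ => ?_
        gcongr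
        exact_mod_cast card_filter_image_subset_le R
    _ ≤ ∑ R ∈ 𝓡, ((q₀ : ℝ) ^ q₀) * ((h : ℝ) ^ #R)⁻¹ := by
        refine sum_le_sum fun R hR => ?_
        have hRq : #R ≤ q₀ := (mem_filter.1 hR).2
        gcongr
    _ = ((q₀ : ℝ) ^ q₀) * ∑ R ∈ 𝓡, ((h : ℝ) ^ #R)⁻¹ := by rw [mul_sum]
    _ ≤ ((q₀ : ℝ) ^ q₀) * (q₀ + 1) := by
        gcongr
        -- group the ranges by cardinality: `#{R : #R = c} = C(h, c) ≤ h^c`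
        have hdecomp : 𝓡 = (range (q₀ + 1)).biUnion fun c => (univ : Finset (Fin h)).powersetCard c := by
          ext R
          simp only [𝓡, mem_filter, mem_powerset, mem_biUnion, mem_range, mem_powersetCard]
          constructor
          · rintro ⟨hR, hc⟩; exact ⟨#R, by omega, hR, rfl⟩
          · rintro ⟨c, hc, hR, rfl⟩; exact ⟨hR, by omega⟩
        rw [hdecomp, sum_biUnion]
        · calc ∑ c ∈ range (q₀ + 1), ∑ R ∈ (univ : Finset (Fin h)).powersetCard c, ((h : ℝ) ^ #R)⁻¹
              = ∑ c ∈ range (q₀ + 1), ((h.choose c : ℕ) : ℝ) * ((h : ℝ) ^ c)⁻¹ := by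
                refine sum_congr rfl fun c _ => ?_
                rw [sum_congr rfl fun R hR => by rw [(mem_powersetCard.1 hR).2], sum_const, nsmul_eq_mul,
                  card_powersetCard, card_univ, Fintype.card_fin]
            _ ≤ ∑ _c ∈ range (q₀ + 1), (1 : ℝ) := by
                refine sum_le_sum fun c _ => ?_
                have h1 : ((h.choose c : ℕ) : ℝ) ≤ (h : ℝ) ^ c := by exact_mod_cast Nat.choose_le_pow h c
                have h2 : (0 : ℝ) < (h : ℝ) ^ c := by positivity
                rw [← div_eq_mul_inv, div_le_one h2]
                exact h1
            _ = q₀ + 1 := by simp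
        · intro c _ c' _ hcc
          exact Finset.pairwise_disjoint_powersetCard _ hcc
    _ = (q₀ + 1) * (q₀ : ℝ) ^ q₀ := by ring

end Helpers

end

end Summit.PneNP.PneNP.Theorems.CliqueExtLowerBound.Negative
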